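/-
Copyright (c) 2026. All rights reserved.
Released under Apache 2.0 license as described in the file LICENSE.
Authors: abc-iut cell, prover seat abc-iut-L4-d1 (gen 8; row «HYP⇒NONAB@FINITE-TYPE», F3: a NON-COMPACT Riemann
surface of finite type uniformised by `ℍ` has non-abelian `π₁`; [AbsTopIII] Prop 4.2 (i)/Cor 4.5 at print's
hypothesis «hyperbolic of finite type»).
-/
import Literature.AnabelianGeometry.AbsoluteAnabelian.ArchimedeanHolFieldFunctorGeometricPSLPuncturedGenuineUnconditional
import Literature.AnabelianGeometry.AbsoluteAnabelian.ArchimedeanHolFieldFunctorGeometricPSLCuspFunction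
import Literature.AnabelianGeometry.AbsoluteAnabelian.FiniteTypeLiouville
import Literature.GroupTheory.CombinatorialGroupTheory.FreeGroupCentralizers
import Literature.Geometry.Manifold.QuotientMaps
import HarnessLib

/-!
# A non-compact Riemann surface of finite type uniformised by `ℍ` has non-abelian `π₁`;
# [AbsTopIII] Prop 4.2 (i) / Cor 4.5 at every NON-COMPACT HYPERBOLIC Riemann surface of finite type (PROOF-ONLY)

S. Mochizuki, *Topics in Absolute Anabelian Geometry III*, Cor. 2.4 p.54 («Let `X` be a HYPERBOLIC Riemann
surface of finite type; `U^top → X^top` its universal covering …»), Def. 4.1 (i) p.101, proof of Prop. 4.2 (i)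
p.106, Cor. 4.5 pp.107–109 [MochizukiAbsTopIII2015]; H. M. Farkas, I. Kra, *Riemann Surfaces* (1992), IV.5–IV.6
(the trichotomy by the universal covering; surfaces with abelian `π₁`) [FarkasKra1992].

The tree's geometric column for Prop 4.2 (i)/Cor 4.5 (abc-iut-w5-d096, abc-iut-L4-d1 gen 7:
`HolRS.isIdRigid_EA_and_cor_4_5_full_mapsTo_of_isOfFiniteType_unconditional`) and for Cor 2.4 (b)(c)
(abc-iut-L4-t8) is stated at «finite type ∧ non-compact ∧ `π₁` NON-ABELIAN», and the tree proves
«`π₁` non-abelian ⇒ uniformised by `ℍ`» (`exists_pslQuotient_iso_of_nonabelian_fundamentalGroup_unconditional`).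
This file proves the CONVERSE at non-compact finite type, so that the column is stated at print's hypothesis
«`X` hyperbolic (uniformised by `ℍ`) of finite type»:

* ★ `HolRS.exists_mul_ne_mul_fundamentalGroup_of_cover_of_isOfFiniteType` — if `X ∈ HolRS` is of finite
  type, not compact, and admits a holomorphic covering `k : ℍ → X`, then `π₁(X, x₀)` is NON-ABELIAN.
  Proof: if `π₁` were abelian then, being free of finite rank ((α), `puncturedCompactRiemannSurfaceFreePi1_holds`
  via `isFreeOfFiniteRank_fundamentalGroup_of_isOfFiniteType'`), it is cyclic, so the Möbius deck group
  `Λ̄ ≅ π₁` of `k` (`exists_pslQuotient_iso_of_cover_pi1`) is cyclic, `Λ̄ = ⟨γ⟩`; by (P) (abc-iut-w6-d031,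
  `exists_parabolic_mem_of_cover_of_isOfFiniteType`) `Λ̄` contains a parabolic `π(t) = π(A T_h A⁻¹)`, with which
  `γ` commutes, so `γ = π(A T_x A⁻¹)`, `x ≠ 0` (`exists_eq_conj_translSL_of_commute`); the bounded cusp
  function `exp (2πi (A⁻¹ • τ)/|x|)` (`exists_cuspFunction`) is `Λ̄`-invariant, descends to a non-constant
  holomorphic map `X → 𝔻` (`QuotientManifold.mdifferentiable_invariantEquiv_iff` and the iso `ℍ/Λ̄ ≅ X`),
  contradicting Liouville at finite type (`apply_eq_apply_of_isOfFiniteType_of_norm_lt`).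
* `HolRS.nonabelian_fundamentalGroup_iff_exists_cover_of_isOfFiniteType` — at non-compact finite type,
  «`π₁` non-abelian ⟺ uniformised by `ℍ`».
* ★★ `HolRS.isIdRigid_EA_and_cor_4_5_full_mapsTo_of_isOfFiniteType_of_cover` (+ RC twin) — **[AbsTopIII]
  Prop 4.2 (i) id-rigidity ∧ `Cor_4_5_full` at EVERY non-compact HYPERBOLIC (uniformised by `ℍ`) connected
  Riemann surface of finite type** — print's hypothesis; zero named facts.

PROOF-ONLY (no definition, no instance, no named fact); classical; MODEL side of [AbsTopIII] §2/§4 (model ≠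
reconstruction ≠ node); nothing here bears on the disputed [IUTchIII] Cor. 3.12.
-/

set_option autoImplicit false

noncomputable section

namespace Literature.AnabelianGeometry.AbsoluteAnabelian

namespace HolRS

open scoped _root_.Manifold _root_.ContDiff _root_.Topology UpperHalfPlane MatrixGroups
open _root_.MulAction _root_.Function _root_.CategoryTheory _root_.TopologicalSpace
open Literature.IUT.HodgeTheaters (IsFreeOfFiniteRank)
open Literature.NumberTheory.Automorphic.Fuchsian (translSL)
open Literature.Geometry.Manifold (QuotientManifold.invariantEquiv QuotientManifold.invariantEquiv_apply_mk
  QuotientManifold.mdifferentiable_invariantEquiv_iff)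

/-! ### §1 A free group of finite rank with commuting elements is cyclic -/

/-- A free group of finite rank all of whose elements commute is cyclic (rank `≤ 1`).
[cite: FarkasKra1992, IV.6] -/
theorem isCyclic_of_isFreeOfFiniteRank_of_comm {G : Type} [Group G] (hG : IsFreeOfFiniteRank G)
    (hc : ∀ a b : G, a * b = b * a) : IsCyclic G := by
  obtain ⟨n, ⟨ψ⟩⟩ := hG
  haveI : IsCyclic (FreeGroup (Fin n)) :=
    Literature.GroupTheory.CombinatorialGroupTheory.IsFreeGroup.isCyclic_of_comm fun a b => by
      rw [← ψ.apply_symm_apply a, ← ψ.apply_symm_apply b, ← map_mul, hc, map_mul]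
  exact isCyclic_of_surjective ψ.symm ψ.symm.surjective

/-! ### §2 Hyperbolic + finite type + non-compact ⇒ `π₁` non-abelian -/

variable (X : HolRS)

/-- ★ **A non-compact Riemann surface of finite type uniformised by `ℍ` has non-abelian fundamental group.**
For `X ∈ HolRS` of finite type (`IsOfFiniteType`), not compact, and `k : ℍ → X` a holomorphic covering map,
`π₁(X, x₀)` contains two non-commuting elements.  (Classically: `X = X̄ ∖ S`, `S ≠ ∅`, `2g − 2 + |S| > 0`,
`π₁` free of rank `2g + |S| − 1 ≥ 2`; here via cusps and Liouville, see the module docstring.)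
[cite: FarkasKra1992, IV.6] [cite: MochizukiAbsTopIII2015, Corollary 2.4 p.54] -/
theorem exists_mul_ne_mul_fundamentalGroup_of_cover_of_isOfFiniteType (hX : IsOfFiniteType X.carrier)
    (hnc : ¬ CompactSpace X.carrier) {k : ℍ → X.carrier} (hk : IsCoveringMap k)
    (dk : MDifferentiable 𝓘(ℂ, ℂ) 𝓘(ℂ, ℂ) k) (x₀ : X.carrier) :
    ∃ a b : FundamentalGroup X.carrier x₀, a * b ≠ b * a := by
  by_contra hab
  push Not at hab
  -- the Möbius deck group `Λ̄ ≅ π₁` and the iso `ℍ/Λ̄ ≅ X` over `k`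
  obtain ⟨Λ, hPD, hC, hΛ, hπΛ, e, he⟩ := exists_pslQuotient_iso_of_cover_pi1 X hk dk
  obtain ⟨φ⟩ := hπΛ x₀
  have hcomm : ∀ p q : Λ, p * q = q * p := fun p q => by
    rw [← φ.apply_symm_apply p, ← φ.apply_symm_apply q, ← map_mul, hab, map_mul]
  -- (α) `π₁` is free of finite rank, hence `Λ̄` is cyclic
  haveI : IsCyclic Λ :=
    isCyclic_of_surjective φ φ.surjective (hH := isCyclic_of_isFreeOfFiniteRank_of_comm
      (X.isFreeOfFiniteRank_fundamentalGroup_of_isOfFiniteType' hX hnc x₀) hab)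
  obtain ⟨γ, hγ⟩ := IsCyclic.exists_generator (α := Λ)
  -- (P) a parabolic element `π(t) = π(A T_h A⁻¹)` of `Λ̄`
  obtain ⟨t, htΛ, ht⟩ := X.exists_parabolic_mem_of_cover_of_isOfFiniteType hX hnc hk dk Λ hΛ
  obtain ⟨A, h, hh, hAt⟩ := exists_psl_conj_translSL_eq ht
  have hp1 : (QuotientGroup.mk' (Subgroup.center SL(2, ℝ)) t : PSL2R) ≠ 1 := psl_mk_ne_one_of_isParabolic ht
  -- `γ` commutes with `π(t)`, hence is a translation at the same cusp: `γ = π(A) π(T_x) π(A)⁻¹`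
  have hγt : (γ : PSL2R) * QuotientGroup.mk' (Subgroup.center SL(2, ℝ)) (A * translSL h * A⁻¹) =
      QuotientGroup.mk' (Subgroup.center SL(2, ℝ)) (A * translSL h * A⁻¹) * γ := by
    rw [hAt]
    exact congrArg Subtype.val (hcomm γ ⟨_, htΛ⟩)
  obtain ⟨x, hx⟩ := exists_eq_conj_translSL_of_commute hh hγt
  -- `x ≠ 0`: otherwise `γ = 1`, `Λ̄ = 1`, contradicting `π(t) ∈ Λ̄`, `π(t) ≠ 1`
  have hx0 : x ≠ 0 := by
    rintro rfl
    have hγ1 : (γ : PSL2R) = 1 := by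
      rw [hx]
      simp [translSL]
    apply hp1
    obtain ⟨n, hn⟩ := Subgroup.mem_zpowers_iff.mp (hγ ⟨_, htΛ⟩)
    have := congrArg Subtype.val hn
    simp only [SubgroupClass.coe_zpow, hγ1, one_zpow] at this
    exact this.symm
  -- every element of `Λ̄` is a power of `π(A T_y A⁻¹)` for some `y > 0` (`y = ±x`)
  obtain ⟨y, hy, hgen⟩ : ∃ y : ℝ, 0 < y ∧ ∀ q : PSL2R, q ∈ Λ →
      q ∈ Subgroup.zpowers (QuotientGroup.mk' (Subgroup.center SL(2, ℝ)) (A * translSL y * A⁻¹)) := by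
    have hconj : ∀ z : ℝ, (QuotientGroup.mk' (Subgroup.center SL(2, ℝ)) (A * translSL z * A⁻¹) : PSL2R) =
        QuotientGroup.mk' (Subgroup.center SL(2, ℝ)) A * QuotientGroup.mk' (Subgroup.center SL(2, ℝ)) (translSL z) *
          (QuotientGroup.mk' (Subgroup.center SL(2, ℝ)) A)⁻¹ := fun z => by
      rw [map_mul, map_mul, map_inv]
    rcases hx0.lt_or_gt with hneg | hpos
    · refine ⟨-x, neg_pos.mpr hneg, fun q hq => ?_⟩
      have hinv : (QuotientGroup.mk' (Subgroup.center SL(2, ℝ)) (A * translSL (-x) * A⁻¹) : PSL2R) =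
          (γ : PSL2R)⁻¹ := by
        rw [hconj, hx, show translSL (-x) = (translSL x)⁻¹ by simp [translSL], map_inv]
        group
      rw [hinv, Subgroup.zpowers_inv]
      obtain ⟨n, hn⟩ := Subgroup.mem_zpowers_iff.mp (hγ ⟨q, hq⟩)
      exact Subgroup.mem_zpowers_iff.mpr ⟨n, by simpa using congrArg Subtype.val hn⟩
    · refine ⟨x, hpos, fun q hq => ?_⟩
      rw [hconj, ← hx]
      obtain ⟨n, hn⟩ := Subgroup.mem_zpowers_iff.mp (hγ ⟨q, hq⟩)
      exact Subgroup.mem_zpowers_iff.mpr ⟨n, by simpa using congrArg Subtype.val hn⟩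
  -- the bounded cusp function, invariant under `Λ̄`
  obtain ⟨F, hF, hFb, hFinv, τ₁, τ₂, hne⟩ := exists_cuspFunction A hy
  have hFΛ : ∀ q : Λ, ∀ τ : ℍ, F (q • τ) = F τ := by
    intro q τ
    have hγF : ∀ τ : ℍ,
        F ((QuotientGroup.mk' (Subgroup.center SL(2, ℝ)) (A * translSL y * A⁻¹) : PSL2R) • τ) = F τ :=
      fun τ => by rw [QuotientGroup.mk'_apply, psl_mk_smul]; exact hFinv τ
    exact forall_mem_zpowers_smul_eq hγF (q : PSL2R) (hgen q q.2) τ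
  -- descend it to `ℍ/Λ̄`, then to `X`
  haveI : ContinuousConstSMul Λ ℍ := ⟨fun q => continuous_const_smul (q : PSL2R)⟩
  haveI : LocallyCompactSpace ℍ := ChartedSpace.locallyCompactSpace ℂ ℍ
  set Fbar : orbitRel.Quotient Λ ℍ → ℂ := QuotientManifold.invariantEquiv Λ ℍ ℂ ⟨F, hFΛ⟩ with hFbar
  have hFbar_mk : ∀ τ : ℍ, Fbar (Quotient.mk (orbitRel Λ ℍ) τ) = F τ := fun τ =>
    QuotientManifold.invariantEquiv_apply_mk ⟨F, hFΛ⟩ τ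
  have hFbar_d : MDifferentiable 𝓘(ℂ, ℂ) 𝓘(ℂ, ℂ) Fbar :=
    (QuotientManifold.mdifferentiable_invariantEquiv_iff (I := 𝓘(ℂ, ℂ)) (J := 𝓘(ℂ, ℂ)) (n := ω)
      (fun q : Λ => contMDiff_psl_smul (q : PSL2R)) (by simp) ⟨F, hFΛ⟩).mpr hF
  let g : X.carrier → ℂ := fun z => Fbar (e.inv.toFun z)
  have hg : MDifferentiable 𝓘(ℂ, ℂ) 𝓘(ℂ, ℂ) g := hFbar_d.comp e.inv.mdifferentiable
  have hid : ∀ w : (pslQuotient Λ).carrier, e.inv.toFun (e.hom.toFun w) = w := fun w => by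
    have := congrArg (fun f : pslQuotient Λ ⟶ pslQuotient Λ => f.toFun w) e.hom_inv_id
    simp only [comp_toFun, id_toFun, Function.comp_apply, id_eq] at this
    exact this
  have hgk : ∀ τ : ℍ, g (k τ) = F τ := fun τ => by
    simp only [g]
    rw [← he τ, hid]
    exact hFbar_mk τ
  have hgb : ∀ z : X.carrier, ‖g z‖ < 1 := fun z => by
    obtain ⟨τ, hτ⟩ := Quotient.exists_rep (s := orbitRel Λ ℍ) (e.inv.toFun z)
    simp only [g]
    rw [← hτ, hFbar_mk]
    exact hFb τ
  -- Liouville at finite type: `g` is constant — but `g (k τ₁) = F τ₁ ≠ F τ₂ = g (k τ₂)`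
  exact hne (by rw [← hgk τ₁, ← hgk τ₂]; exact apply_eq_apply_of_isOfFiniteType_of_norm_lt hX hg hgb _ _)

/-- **At non-compact finite type, «`π₁` non-abelian» ⟺ «uniformised by `ℍ`» (hyperbolic).**  (`⇒` is the
tree's `exists_pslQuotient_iso_of_nonabelian_fundamentalGroup_unconditional`, uniformisation; `⇐` is
`exists_mul_ne_mul_fundamentalGroup_of_cover_of_isOfFiniteType`.)
[cite: FarkasKra1992, IV.6] [cite: MochizukiAbsTopIII2015, Corollary 2.4 p.54] -/
theorem nonabelian_fundamentalGroup_iff_exists_cover_of_isOfFiniteType (hX : IsOfFiniteType X.carrier)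
    (hnc : ¬ CompactSpace X.carrier) (x₀ : X.carrier) :
    (∃ a b : FundamentalGroup X.carrier x₀, a * b ≠ b * a) ↔
      ∃ k : ℍ → X.carrier, IsCoveringMap k ∧ MDifferentiable 𝓘(ℂ, ℂ) 𝓘(ℂ, ℂ) k := by
  constructor
  · intro hab
    haveI := secondCountableTopology_of_isOfFiniteType X hX
    obtain ⟨k, Λ, _, _, hk, dk, -⟩ := exists_pslQuotient_iso_of_nonabelian_fundamentalGroup_unconditional X x₀ hab
    exact ⟨k, hk, dk⟩
  · rintro ⟨k, hk, dk⟩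
    exact X.exists_mul_ne_mul_fundamentalGroup_of_cover_of_isOfFiniteType hX hnc hk dk x₀

/-! ### §3 [AbsTopIII] Prop 4.2 (i) / Cor 4.5 at print's hypothesis -/

/-- ★★ **[AbsTopIII] Prop 4.2 (i) id-rigidity ∧ `Cor_4_5_full` at EVERY non-compact HYPERBOLIC connected
Riemann surface of finite type** — print's standing hypothesis (Cor 2.4 p.54, Def 4.1 (i) p.101: «hyperbolic
Riemann surface of finite type», hyperbolic = uniformised by the upper half-plane), holomorphic morphisms;
NO named-fact hypothesis.  (abc-iut-L4-d1 gen 7's `…_unconditional` with its binder «`π₁` non-abelian»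
discharged by `exists_mul_ne_mul_fundamentalGroup_of_cover_of_isOfFiniteType`.)
[cite: MochizukiAbsTopIII2015, Proposition 4.2 (i) proof p.106] [cite: MochizukiAbsTopIII2015, Corollary 4.5 pp.107–109]
[cite: FarkasKra1992, IV.5.5–IV.5.6] -/
theorem isIdRigid_EA_and_cor_4_5_full_mapsTo_of_isOfFiniteType_of_cover (hX : IsOfFiniteType X.carrier)
    (hnc : ¬ CompactSpace X.carrier) {k : ℍ → X.carrier} (hk : IsCoveringMap k)
    (dk : MDifferentiable 𝓘(ℂ, ℂ) 𝓘(ℂ, ℂ) k) :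
    IsIdRigid (geometricAutHolFieldFunctor fun Y : HolRS => Nonempty (Y ⟶ X)).EA ∧
      AbsTopIII.Cor_4_5_full
        (archLogFrobeniusData (geometricAutHolFieldFunctor fun Y : HolRS => Nonempty (Y ⟶ X)))
        (archTelecoreData (geometricAutHolFieldFunctor fun Y : HolRS => Nonempty (Y ⟶ X))) :=
  X.isIdRigid_EA_and_cor_4_5_full_mapsTo_of_isOfFiniteType_unconditional hX hnc (k UpperHalfPlane.I)
    (X.exists_mul_ne_mul_fundamentalGroup_of_cover_of_isOfFiniteType hX hnc hk dk _)

/-- ★★ **The same for print's RC-holomorphic morphisms**, NO named-fact hypothesis.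
[cite: MochizukiAbsTopIII2015, Proposition 4.2 (i) proof p.106] [cite: FarkasKra1992, IV.5.5–IV.5.6] -/
theorem RC.isIdRigid_EA_and_cor_4_5_full_mapsTo_of_isOfFiniteType_of_cover (hX : IsOfFiniteType X.carrier)
    (hnc : ¬ CompactSpace X.carrier) {k : ℍ → X.carrier} (hk : IsCoveringMap k)
    (dk : MDifferentiable 𝓘(ℂ, ℂ) 𝓘(ℂ, ℂ) k) :
    IsIdRigid (geometricAutHolFieldFunctorRC fun Y : RC => Nonempty (Y ⟶ toRC.obj X)).EA ∧
      AbsTopIII.Cor_4_5_full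
        (archLogFrobeniusData (geometricAutHolFieldFunctorRC fun Y : RC => Nonempty (Y ⟶ toRC.obj X)))
        (archTelecoreData (geometricAutHolFieldFunctorRC fun Y : RC => Nonempty (Y ⟶ toRC.obj X))) :=
  RC.isIdRigid_EA_and_cor_4_5_full_mapsTo_of_isOfFiniteType_unconditional X hX hnc (k UpperHalfPlane.I)
    (X.exists_mul_ne_mul_fundamentalGroup_of_cover_of_isOfFiniteType hX hnc hk dk _)

end HolRS

end Literature.AnabelianGeometry.AbsoluteAnabelian

end
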